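import Summits.Ventures.HodgeRepro2.T5SU11JacobiDuplication

/-!
# Wendel's inequalities and the Gamma-ratio asymptotic `Γ(x + s)/(x^s Γ(x)) → 1`

The symmetric closed form of `T5SU11JacobiDuplication`, `m̂_k(λ) = π Γ((k−λ)/2) Γ((k+λ)/2 − 1)/Γ(k/2)²`, is
a product of two Gamma RATIOS `Γ(x + s)/Γ(x)` at `x = k/2`. Their large-`x` behaviour is Wendel's
theorem (J. G. Wendel, *Note on the gamma function*, Amer. Math. Monthly 55 (1948) 563–564): for `x > 0`
and `0 ≤ s ≤ 1`,

  **`(x/(x+s))^{1−s} ≤ Γ(x + s)/(x^s Γ(x)) ≤ 1`**   (`Gamma_add_le`, `Gamma_add_ge`),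

both halves being the log-convexity of `Γ` (Mathlib's Bohr–Mollerup
`Real.Gamma_mul_add_mul_le_rpow_Gamma_mul_rpow_Gamma`) at the two convex combinations
`x + s = (1−s)·x + s·(x+1)` and `x + 1 = s·(x+s) + (1−s)·(x+s+1)` together with `Γ(x+1) = x Γ(x)`. Hence
**`Γ(x + s)/(x^s Γ(x)) → 1` as `x → ∞`** for `0 ≤ s ≤ 1` (`tendsto_Gamma_ratio_of_mem_Icc`), and, shifting
`s` by integers through the functional equation (`tendsto_Gamma_ratio_add_one`, `…_sub_one`,
`Int.induction_on` on `⌊s⌋`), **for every real `s`** (`tendsto_Gamma_ratio`); the two-ratio form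
`Γ(x+s) Γ(x+t)/(x^{s+t} Γ(x)²) → 1` (`tendsto_Gamma_ratio_mul`) is what the Jacobi transform needs.
Nothing is claimed about (N).

Blind lane: Mathlib + the HodgeRepro2 prefix only; no sorry; axioms ⊆ {propext, Classical.choice,
Quot.sound}.
-/

namespace Summit.Ventures.HodgeRepro2.T5SU11WendelGammaRatio

open Filter Topology Set
open scoped Real

/-! ### Wendel's inequalities -/

/-- **Wendel, upper half**: `Γ(x + s) ≤ x^s Γ(x)` for `x > 0`, `0 ≤ s ≤ 1`. -/
theorem Gamma_add_le {x s : ℝ} (hx : 0 < x) (hs0 : 0 ≤ s) (hs1 : s ≤ 1) :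
    Real.Gamma (x + s) ≤ x ^ s * Real.Gamma x := by
  rcases hs0.lt_or_eq with hs0 | rfl
  · rcases hs1.lt_or_eq with hs1 | rfl
    · have h := Real.Gamma_mul_add_mul_le_rpow_Gamma_mul_rpow_Gamma hx (by linarith : 0 < x + 1)
        (by linarith : 0 < 1 - s) hs0 (by ring)
      rw [show (1 - s) * x + s * (x + 1) = x + s by ring, Real.Gamma_add_one hx.ne',
        Real.mul_rpow hx.le (Real.Gamma_pos_of_pos hx).le, ← mul_assoc, mul_comm (Real.Gamma x ^ (1 - s)),
        mul_assoc, ← Real.rpow_add (Real.Gamma_pos_of_pos hx), sub_add_cancel, Real.rpow_one] at h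
      exact h
    · rw [Real.Gamma_add_one hx.ne', Real.rpow_one]
  · rw [add_zero, Real.rpow_zero, one_mul]

/-- **Wendel, lower half**: `x Γ(x) ≤ (x + s)^{1−s} Γ(x + s)` for `x > 0`, `0 ≤ s ≤ 1`. -/
theorem Gamma_add_ge {x s : ℝ} (hx : 0 < x) (hs0 : 0 ≤ s) (hs1 : s ≤ 1) :
    x * Real.Gamma x ≤ (x + s) ^ (1 - s) * Real.Gamma (x + s) := by
  rcases hs0.lt_or_eq with hs0 | rfl
  · rcases hs1.lt_or_eq with hs1 | rfl
    · have hxs : 0 < x + s := by linarith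
      have h := Real.Gamma_mul_add_mul_le_rpow_Gamma_mul_rpow_Gamma hxs (by linarith : 0 < x + s + 1)
        hs0 (by linarith : 0 < 1 - s) (by ring)
      rw [show s * (x + s) + (1 - s) * (x + s + 1) = x + 1 by ring, Real.Gamma_add_one hx.ne',
        Real.Gamma_add_one hxs.ne', Real.mul_rpow hxs.le (Real.Gamma_pos_of_pos hxs).le] at h
      refine h.trans_eq ?_
      have e : Real.Gamma (x + s) ^ s * Real.Gamma (x + s) ^ (1 - s) = Real.Gamma (x + s) := by
        rw [← Real.rpow_add (Real.Gamma_pos_of_pos hxs), add_sub_cancel, Real.rpow_one]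
      calc Real.Gamma (x + s) ^ s * ((x + s) ^ (1 - s) * Real.Gamma (x + s) ^ (1 - s))
          = (x + s) ^ (1 - s) * (Real.Gamma (x + s) ^ s * Real.Gamma (x + s) ^ (1 - s)) := by ring
        _ = (x + s) ^ (1 - s) * Real.Gamma (x + s) := by rw [e]
    · rw [Real.Gamma_add_one hx.ne', sub_self, Real.rpow_zero, one_mul]
  · rw [add_zero, sub_zero, Real.rpow_one]

/-- The ratio `Γ(x + s)/(x^s Γ(x))` is at most `1`. -/
theorem Gamma_ratio_le_one {x s : ℝ} (hx : 0 < x) (hs0 : 0 ≤ s) (hs1 : s ≤ 1) :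
    Real.Gamma (x + s) / (x ^ s * Real.Gamma x) ≤ 1 := by
  rw [div_le_one (mul_pos (Real.rpow_pos_of_pos hx _) (Real.Gamma_pos_of_pos hx))]
  exact Gamma_add_le hx hs0 hs1

/-- The ratio `Γ(x + s)/(x^s Γ(x))` is at least `(x/(x+s))^{1−s}`. -/
theorem Gamma_ratio_ge {x s : ℝ} (hx : 0 < x) (hs0 : 0 ≤ s) (hs1 : s ≤ 1) :
    (x / (x + s)) ^ (1 - s) ≤ Real.Gamma (x + s) / (x ^ s * Real.Gamma x) := by
  have hxs : 0 < x + s := by linarith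
  have hG : 0 < Real.Gamma x := Real.Gamma_pos_of_pos hx
  have hxs' : 0 < x ^ s := Real.rpow_pos_of_pos hx _
  have hpow : 0 < (x + s) ^ (1 - s) := Real.rpow_pos_of_pos hxs _
  rw [Real.div_rpow hx.le hxs.le, le_div_iff₀ (mul_pos hxs' hG), div_mul_eq_mul_div,
    div_le_iff₀ hpow]
  -- `x^{1−s} · x^s · Γ(x) = x Γ(x) ≤ (x+s)^{1−s} Γ(x+s)`
  have e : x ^ (1 - s) * (x ^ s * Real.Gamma x) = x * Real.Gamma x := by
    rw [← mul_assoc, ← Real.rpow_add hx, sub_add_cancel, Real.rpow_one]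
  rw [e]
  linarith [Gamma_add_ge hx hs0 hs1]

/-! ### The ratio limit -/

/-- `(x/(x+s))^{1−s} → 1` as `x → ∞`. -/
theorem tendsto_div_add_rpow (s c : ℝ) :
    Tendsto (fun x : ℝ => (x / (x + s)) ^ c) atTop (𝓝 1) := by
  have h1 : Tendsto (fun x : ℝ => x / (x + s)) atTop (𝓝 1) := by
    have h2 : Tendsto (fun x : ℝ => s / (x + s)) atTop (𝓝 0) :=
      tendsto_const_nhds.div_atTop (tendsto_atTop_add_const_right _ s tendsto_id)
    have h3 : Tendsto (fun x : ℝ => 1 - s / (x + s)) atTop (𝓝 (1 - 0)) := tendsto_const_nhds.sub h2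
    rw [sub_zero] at h3
    refine h3.congr' ?_
    filter_upwards [eventually_gt_atTop (|s|)] with x hx
    have hxs : x + s ≠ 0 := by
      have := neg_abs_le s
      linarith
    field_simp
    ring
  have := h1.rpow_const (p := c) (Or.inl one_ne_zero)
  rwa [Real.one_rpow] at this

/-- **`Γ(x + s)/(x^s Γ(x)) → 1`** for `0 ≤ s ≤ 1` (Wendel's squeeze). -/
theorem tendsto_Gamma_ratio_of_mem_Icc {s : ℝ} (hs0 : 0 ≤ s) (hs1 : s ≤ 1) :
    Tendsto (fun x : ℝ => Real.Gamma (x + s) / (x ^ s * Real.Gamma x)) atTop (𝓝 1) := by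
  refine tendsto_of_tendsto_of_tendsto_of_le_of_le' (tendsto_div_add_rpow s (1 - s))
    tendsto_const_nhds ?_ ?_
  · filter_upwards [eventually_gt_atTop (0 : ℝ)] with x hx
    exact Gamma_ratio_ge hx hs0 hs1
  · filter_upwards [eventually_gt_atTop (0 : ℝ)] with x hx
    exact Gamma_ratio_le_one hx hs0 hs1

/-- Shift `s ↦ s + 1`: `Γ(x+s+1)/(x^{s+1} Γ(x)) = ((x+s)/x) · Γ(x+s)/(x^s Γ(x))`. -/
theorem tendsto_Gamma_ratio_add_one {s : ℝ}
    (h : Tendsto (fun x : ℝ => Real.Gamma (x + s) / (x ^ s * Real.Gamma x)) atTop (𝓝 1)) :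
    Tendsto (fun x : ℝ => Real.Gamma (x + (s + 1)) / (x ^ (s + 1) * Real.Gamma x)) atTop (𝓝 1) := by
  have h1 : Tendsto (fun x : ℝ => (x + s) / x) atTop (𝓝 1) := by
    have h2 : Tendsto (fun x : ℝ => s / x) atTop (𝓝 0) := tendsto_const_nhds.div_atTop tendsto_id
    have h3 : Tendsto (fun x : ℝ => 1 + s / x) atTop (𝓝 (1 + 0)) := tendsto_const_nhds.add h2
    rw [add_zero] at h3
    refine h3.congr' ?_
    filter_upwards [eventually_gt_atTop (0 : ℝ)] with x hx
    field_simp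
  have := h1.mul h
  rw [one_mul] at this
  refine this.congr' ?_
  filter_upwards [eventually_gt_atTop (0 : ℝ), eventually_gt_atTop (-s)] with x hx hxs
  have hxs' : x + s ≠ 0 := by
    intro h0
    linarith
  rw [← add_assoc, Real.Gamma_add_one hxs', Real.rpow_add_one hx.ne']
  have hG : Real.Gamma x ≠ 0 := (Real.Gamma_pos_of_pos hx).ne'
  have hxp : x ^ s ≠ 0 := (Real.rpow_pos_of_pos hx _).ne'
  field_simp

/-- Shift `s ↦ s − 1`: `Γ(x+s−1)/(x^{s−1} Γ(x)) = (x/(x+s−1)) · Γ(x+s)/(x^s Γ(x))`. -/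
theorem tendsto_Gamma_ratio_sub_one {s : ℝ}
    (h : Tendsto (fun x : ℝ => Real.Gamma (x + s) / (x ^ s * Real.Gamma x)) atTop (𝓝 1)) :
    Tendsto (fun x : ℝ => Real.Gamma (x + (s - 1)) / (x ^ (s - 1) * Real.Gamma x)) atTop (𝓝 1) := by
  have h1 : Tendsto (fun x : ℝ => x / (x + (s - 1))) atTop (𝓝 1) := by
    have := tendsto_div_add_rpow (s - 1) 1
    simpa only [Real.rpow_one] using this
  have := h1.mul h
  rw [one_mul] at this
  refine this.congr' ?_
  filter_upwards [eventually_gt_atTop (0 : ℝ), eventually_gt_atTop (1 - s)] with x hx hxs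
  have hxs' : x + (s - 1) ≠ 0 := by
    intro h0
    linarith
  have e : Real.Gamma (x + s) = (x + (s - 1)) * Real.Gamma (x + (s - 1)) := by
    rw [← Real.Gamma_add_one hxs']
    congr 1
    ring
  rw [e, Real.rpow_sub_one hx.ne']
  have hG : Real.Gamma x ≠ 0 := (Real.Gamma_pos_of_pos hx).ne'
  have hxp : x ^ s ≠ 0 := (Real.rpow_pos_of_pos hx _).ne'
  field_simp

/-- **THE GAMMA-RATIO ASYMPTOTIC**: `Γ(x + s)/(x^s Γ(x)) → 1` as `x → ∞`, for EVERY real `s`. -/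
theorem tendsto_Gamma_ratio (s : ℝ) :
    Tendsto (fun x : ℝ => Real.Gamma (x + s) / (x ^ s * Real.Gamma x)) atTop (𝓝 1) := by
  have hf := tendsto_Gamma_ratio_of_mem_Icc (Int.fract_nonneg s) (Int.fract_lt_one s).le
  have key : ∀ n : ℤ, Tendsto (fun x : ℝ => Real.Gamma (x + (Int.fract s + n))
      / (x ^ (Int.fract s + n) * Real.Gamma x)) atTop (𝓝 1) := by
    intro n
    induction n using Int.induction_on with
    | zero => simpa using hf
    | succ n ih =>
      have h := tendsto_Gamma_ratio_add_one ih
      have e : Int.fract s + (((n : ℤ) + 1 : ℤ) : ℝ) = Int.fract s + ((n : ℤ) : ℝ) + 1 := by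
        push_cast
        ring
      rw [e]
      exact h
    | pred n ih =>
      have h := tendsto_Gamma_ratio_sub_one ih
      have e : Int.fract s + ((-(n : ℤ) - 1 : ℤ) : ℝ) = Int.fract s + ((-(n : ℤ) : ℤ) : ℝ) - 1 := by
        push_cast
        ring
      rw [e]
      exact h
  have := key ⌊s⌋
  rwa [Int.fract, sub_add_cancel] at this

/-- **The two-ratio form**: `Γ(x+s) Γ(x+t)/(x^{s+t} Γ(x)²) → 1` as `x → ∞`. -/
theorem tendsto_Gamma_ratio_mul (s t : ℝ) :
    Tendsto (fun x : ℝ => Real.Gamma (x + s) * Real.Gamma (x + t) / (x ^ (s + t) * Real.Gamma x ^ 2))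
      atTop (𝓝 1) := by
  have := (tendsto_Gamma_ratio s).mul (tendsto_Gamma_ratio t)
  rw [one_mul] at this
  refine this.congr' ?_
  filter_upwards [eventually_gt_atTop (0 : ℝ)] with x hx
  have hG : Real.Gamma x ≠ 0 := (Real.Gamma_pos_of_pos hx).ne'
  have hs : x ^ s ≠ 0 := (Real.rpow_pos_of_pos hx _).ne'
  have ht : x ^ t ≠ 0 := (Real.rpow_pos_of_pos hx _).ne'
  rw [Real.rpow_add hx]
  field_simp

end Summit.Ventures.HodgeRepro2.T5SU11WendelGammaRatio
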